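/-
b2b-lace packet, ANALYTIC ORACLE seat gen 8 (unit `b2b-lace-oracle-g8`).  The one-step recursion in the
SRW-step index `l` of the integrals `I_{n,l}` and `𝓙_{n,l}`, and a norm lemma for the cell `𝒳`.
d-generic; no dimension sentence.
-/
import Literature.Probability.FitznerVanDerHofstad2017.NobleF3WeightedLine
import HarnessLib

/-!
# One SRW step in `l`: `I_{n,l+1} = D ⋆ I_{n,l}`, `𝓙_{n,l+1} = D ⋆ 𝓙_{n,l}`

CITATION HEADER (PLACEMENT v2). Part of a certified REPRODUCTION of R. Fitzner, R. van der Hofstad,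
*Generalized approach to the non-backtracking lace expansion*, Probab. Theory Related Fields 169 (2017)
1041–1119 [NoBLE17] (arXiv:1506.07969 numbering):

> [NoBLE17] (3.34)–(3.35) p. 1071: "`I_{n,l}(x) = ∫ D̂^l(k) … e^{ik·x}`" … "so that `I_{n,l}(e_1) = I_{n,l+1}(0)`";
> (3.29)–(3.30) p. 1070 (the weighted line `𝓙_{n,l}`).

What is proved (kernel theorems about the tree's `srwI`, `srwJ`; cites are locators):
* `srwI_succ_eq_stepAvg` — `I_{n,l+1}(x) = (2d)⁻¹ Σ_e I_{n,l}(x − e)` (`2n+1 ≤ d`), from the x-space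
  representation `Σ_y p_1(y) I_{n,l}(x − y) = I_{n,l+1}(x)` (`tsum_prob_mul_srwI`);
* `srwJ_succ_eq_stepAvg` — the same for `𝓙 = srwJ d N` (`2(N+1)+1 ≤ d`), `𝓙` being a finite linear
  combination of shifted `I`'s; hence `srwJ_succ_zero_le`: `𝓙_{N,l+1}(0) ≤ M` whenever `𝓙_{N,l} ≤ M`
  off the origin (used for the cell `(1,6,{0})` of `𝒮`: `𝓙_{1,6}(0)` is an average of `𝓙_{1,5}(±e_j)`);
* `two_le_sum_abs_of_mem_calX` — `x ∈ 𝒳 = {‖x‖₂ > 1}` implies `‖x‖₁ ≥ 2` (integer points), the region of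
  the `S2` shell theorems.
-/

noncomputable section

namespace Literature.Probability.FitznerVanDerHofstad2017

open Finset
open Literature.Probability.LatticeModels
open Literature.Barriers.CriticalPhenomena
open scoped BigOperators

variable {d : ℕ}

/-- A unit step vector is not `0`. [folklore] -/
theorem srwStepVec_ne_zero (v : SRW.Dir d) : SRW.stepVec v ≠ 0 := by
  intro h
  have h1 := congrFun h v.1
  rw [SRW.stepVec_apply] at h1
  simp only [if_true, Pi.zero_apply] at h1
  split_ifs at h1
  simp at h1

/-- **One SRW step in `l`**: `I_{n,l+1}(x) = (2d)⁻¹ Σ_e I_{n,l}(x − e)` (`2n+1 ≤ d`).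
[cite: FitznerVanDerHofstad2016NoBLE, (3.34)–(3.35) p. 1071] -/
theorem srwI_succ_eq_stepAvg {n : ℕ} (hd : 2 * n + 1 ≤ d) (l : ℕ) (x : Site d) :
    srwI d n (l + 1) x = stepAvg (srwI d n l) x := by
  rw [stepAvg, ← tsum_prob_mul_srwI hd 1 l x]
  have hp1 : ∀ y : Site d, SRW.prob d 1 y * srwI d n l (x - y)
      = ∑ v : SRW.Dir d, (if y = SRW.stepVec v then srwI d n l (x - SRW.stepVec v) / (2 * d) else 0) := by
    intro y
    rw [prob_succ_eq_sum_dir, Finset.sum_div, Finset.sum_mul]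
    refine Finset.sum_congr rfl fun v _ => ?_
    rw [SRW.prob_zero]
    by_cases h : y = SRW.stepVec v
    · subst h; rw [sub_self, if_pos rfl, if_pos rfl]; ring
    · simp [h, sub_ne_zero.2 h]
  simp_rw [hp1]
  have hs : ∀ v : SRW.Dir d, Summable fun y : Site d =>
      (if y = SRW.stepVec v then srwI d n l (x - SRW.stepVec v) / (2 * d) else 0) := fun v =>
    summable_of_ne_finset_zero (s := {SRW.stepVec v}) fun y hy => by
      rw [Finset.mem_singleton] at hy; rw [if_neg hy]
  rw [Summable.tsum_finsetSum (fun v _ => hs v), Finset.sum_div]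
  exact Finset.sum_congr rfl fun v _ => tsum_ite_eq (SRW.stepVec v) _

/-- **One SRW step in `l` for `𝓙`**: `𝓙_{N,l+1}(x) = (2d)⁻¹ Σ_e 𝓙_{N,l}(x − e)` (`srwJ d N`, `2(N+1)+1 ≤ d`).
[cite: FitznerVanDerHofstad2016NoBLE, (3.29)–(3.30) p. 1070 and (3.34)–(3.35) p. 1071] -/
theorem srwJ_succ_eq_stepAvg {N : ℕ} (hd : 2 * (N + 1) + 1 ≤ d) (l : ℕ) (x : Site d) :
    srwJ d N (l + 1) x = stepAvg (srwJ d N l) x := by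
  have hd0 : (0 : ℝ) < d := by exact_mod_cast (show 0 < d by omega)
  have h2d : (2 * (d : ℝ)) ≠ 0 := by positivity
  have hA : ∀ y, srwI d N (l + 2) y = stepAvg (srwI d N (l + 1)) y :=
    fun y => srwI_succ_eq_stepAvg (by omega) (l + 1) y
  have hB : ∀ y, srwI d (N + 1) (l + 1) y = stepAvg (srwI d (N + 1) l) y :=
    fun y => srwI_succ_eq_stepAvg hd l y
  -- both sides times `2d`
  rw [stepAvg, eq_div_iff h2d]
  simp only [srwJ_def]
  rw [hA x, hB x]
  simp only [hB (x + axisVec _ 2), hB (x - axisVec _ 2), stepAvg]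
  simp only [Finset.sum_add_distrib, Finset.sum_sub_distrib, ← Finset.sum_div]
  have harg1 : ∀ (ι : Fin d) (w : SRW.Dir d), x + axisVec ι 2 - SRW.stepVec w = x - SRW.stepVec w + axisVec ι 2 :=
    fun ι w => add_sub_right_comm _ _ _
  have harg2 : ∀ (ι : Fin d) (w : SRW.Dir d), x - axisVec ι 2 - SRW.stepVec w = x - SRW.stepVec w - axisVec ι 2 :=
    fun ι w => sub_right_comm _ _ _
  simp only [harg1, harg2]
  have hc1 : ∑ ι : Fin d, ∑ w : SRW.Dir d, srwI d (N + 1) l (x - SRW.stepVec w + axisVec ι 2)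
      = ∑ w : SRW.Dir d, ∑ ι : Fin d, srwI d (N + 1) l (x - SRW.stepVec w + axisVec ι 2) := Finset.sum_comm
  have hc2 : ∑ ι : Fin d, ∑ w : SRW.Dir d, srwI d (N + 1) l (x - SRW.stepVec w - axisVec ι 2)
      = ∑ w : SRW.Dir d, ∑ ι : Fin d, srwI d (N + 1) l (x - SRW.stepVec w - axisVec ι 2) := Finset.sum_comm
  rw [hc1, hc2]
  field_simp

/-- Hence an off-origin bound for `𝓙_{N,l}` bounds `𝓙_{N,l+1}(0)` (an average of `𝓙_{N,l}(−e)`, `e ≠ 0`).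
[cite: FitznerVanDerHofstad2016NoBLE, (3.34)–(3.35) p. 1071] -/
theorem srwJ_succ_zero_le {N : ℕ} (hd : 2 * (N + 1) + 1 ≤ d) (l : ℕ) {M : ℝ}
    (h : ∀ x : Site d, x ≠ 0 → srwJ d N l x ≤ M) : srwJ d N (l + 1) 0 ≤ M := by
  have hd0 : (0 : ℝ) < d := by exact_mod_cast (show 0 < d by omega)
  rw [srwJ_succ_eq_stepAvg hd l 0, stepAvg, div_le_iff₀ (by positivity)]
  calc ∑ w : SRW.Dir d, srwJ d N l (0 - SRW.stepVec w) ≤ ∑ _w : SRW.Dir d, M :=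
        Finset.sum_le_sum fun w _ => h _ (by rw [zero_sub, neg_ne_zero]; exact srwStepVec_ne_zero w)
    _ = M * (2 * d) := by
        rw [Finset.sum_const, Finset.card_univ, nsmul_eq_mul, SRW.card_dir]; push_cast; ring

/-- `x ∈ 𝒳 = {‖x‖₂ > 1}` implies `‖x‖₁ ≥ 2` for lattice points. [folklore] -/
theorem two_le_sum_abs_of_mem_calX (x : Site d) (hx : x ∈ calX d) : (2 : ℤ) ≤ ∑ j, |x j| := by
  by_contra hlt
  have h1 : ∑ j, |x j| ≤ 1 := by omega
  have h1r : ∑ j, |((x j : ℤ) : ℝ)| ≤ 1 := by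
    have : ((∑ j, |x j| : ℤ) : ℝ) ≤ 1 := by exact_mod_cast h1
    simpa [Int.cast_sum, Int.cast_abs] using this
  have hsq : ∑ j, ((x j : ℤ) : ℝ) ^ 2 ≤ 1 := by
    calc ∑ j, ((x j : ℤ) : ℝ) ^ 2 = ∑ j, |((x j : ℤ) : ℝ)| ^ 2 := by simp [sq_abs]
      _ ≤ (∑ j, |((x j : ℤ) : ℝ)|) ^ 2 :=
          Finset.sum_sq_le_sq_sum_of_nonneg fun j _ => abs_nonneg _
      _ ≤ 1 := by nlinarith [Finset.sum_nonneg fun j (_ : j ∈ Finset.univ) => abs_nonneg ((x j : ℤ) : ℝ)]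
  have hle : euclidNorm x ≤ 1 := by
    unfold euclidNorm
    calc Real.sqrt (∑ j, ((x j : ℤ) : ℝ) ^ 2) ≤ Real.sqrt 1 := Real.sqrt_le_sqrt hsq
      _ = 1 := Real.sqrt_one
  exact absurd hx (not_lt.2 hle)

end Literature.Probability.FitznerVanDerHofstad2017
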